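import Summits.ABC.IUTFork.Thm311RealInd1UnitsShearStrip
import Summits.ABC.IUTFork.Thm311RealInd1StripLattices
import HarnessLib

/-!
# The unit-group shear at `v₇ = (√7)` of `ℚ(√7)`, V: the BASE-FIELD UNIT LINE — the located `d = 2`
# print input for the R9f `∃`-horn, and why it does not discharge the exact-shear residual

Record file (D-0012) of the abc-iut cell (TEAM R, lead seat abc-iut-c312-14 = R1, gen 8; row
«R9f-D2-LIT», claimed plan/C312-TEAMS.md 2026-08-26T22:15:02Z on abc-iut-lit gen 9's 21:54:36Z find);
sequel of `Thm311RealInd1UnitsShearStrip.lean`.  TAKES NO SIDE on [IUTchIII] Cor. 3.12.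

BACKGROUND.  GAP-LEDGER row G-c312-14-R9f isolated the `d = 2` residual of the R9f (Ind1)-mover
question as the lifting statement «∃ φ ∈ Aut_top(G_{v₇}), liftUnits v₇ φ = shearFun», and recorded a
presearch verdict «no published construction of a non-geometric `φ` with prescribed abelian trace at a
QUADRATIC MLF is located».  That presearch line is now SUPERSEDED: Hoshi, *On intrinsic Hodge-Tate-ness
of Galois representations of dimension two* (RIMS-1960; Kodai Math. J. 47 (2024) 99–111), Lemma 3.1
(`p_k` odd, `d_k = 2`), pp. 10–11, PROVES that at every quadratic MLF `k` there is a continuous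
automorphism `α` of `G_k` whose induced continuous automorphism `α_n^×` of `𝒪_k^×` does NOT preserve
the base-field unit line `𝒪^×_{k^{(d=1)}} ⊆ 𝒪_k^×` (the image meets it in a non-open subgroup), and
Kondo (arXiv:2512.09231, Introduction p0004 l. 3–4 and Thm. D) constructs such an automorphism of
`G_k` explicitly for `k/ℚ_p` QUADRATIC; cf. also the Jannsen–Wingberg automorphism `ψ_JW` of
Kumpitsch's thesis, §1 p. 8.  [cite: Hoshi2024IntrinsicHodgeTate, Lemma 3.1 (v) pp.10–11]
[cite: Kondo2025OutGaloisMLF, Introduction p0004 and Thm. D] [cite: Kumpitsch2022OuterAutGalois, §1 p.8]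

THIS FILE types what that find gives and what it does not, over the landed chain (p466991 Core ·
p468895 Analytic · p469019 Shear · p469277 Strip):

* `baseSeg` — the log-image of the base-field unit line `μ·𝒪^×_{ℚ₇} ⊆ 𝒪_{v₇}^×`, i.e. Hoshi's
  `𝒪^×_{k^{(d=1)}}` read through the analytic logarithm `L₇`: the sub-lattice
  `{y : (e₇ y)_Ω = 0, ‖e₇ y‖ ≤ ‖Ω‖}` of `K_{v₇}` — with `baseSeg_subset_range` (it consists of unit
  logs), `baseSeg_le_M2`/`baseSeg_ne_M2` (it sits strictly inside the landed `μ·U^{(2)}`-target);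
* witnesses: `exists_mem_unitPreimage_baseSeg` (the criterion-currency subgroup `unitPreimage L₇
  baseSeg` is non-trivial in log), `exists_not_mem_unitPreimage_baseSeg` (and proper), and
  `psiShear_moves_baseSeg` (the landed shear realisation also moves this target);
* **`ind1_strip_moves_baseSeg_of_mover`** — the `d = 2` PRINT-INPUT MOVER: if some
  `φ ∈ Aut_top(G_{v₇})` has a realisation through `L₇` and its units transport `liftUnits v₇ φ` moves
  `unitPreimage L₇ baseSeg`, then print's (Ind1) strip part at `v₇` MOVES the base-line sub-lattice
  `baseSeg`.  The hypothesis is the `L₇`-reading, at `k = K₇ = ℚ₇(√7)`, of EXACTLY what Hoshi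
  Lemma 3.1 (v) establishes (his `α`, [4, Prop. 3.11 (iv)] functoriality = the tree's
  `Genuine.liftM`/`liftUnits`; the "in particular" clause of (v) gives the mod-`μ` form since the image
  meets the line in a NON-OPEN subgroup while `μ`-saturation only costs a finite index — sixth powers);
  discharging it in the kernel needs the mono-anabelian functoriality typed at abstract `φ`, which the
  tree does not yet hold — the hypothesis stays inline per the frozen-FACT-LIST discipline (D-0067);
* `image_eq_baseSeg_iff` — the c312-1 criterion (p456209) instantiated at `baseSeg`: a realised strip
  automorphism fixes `baseSeg` iff its units transport fixes `unitPreimage L₇ baseSeg` both ways;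
* **`exists_shearDefect_shearDefect_ne_one`** — THE SEPARATION: Hoshi's construction has unipotent
  defect of class two — his proof clauses (a)/(b): `β ≠ id` but the SQUARE of `a ↦ β(a)·a⁻¹` is
  trivial — while the landed shear's defect endomorphism `δ(u) = α(u)·u⁻¹` satisfies
  `δ(δ(u₀)) ≠ 1` (indeed `d∘d = −2·d ≠ 0`): the shear is NOT in the class his `α` realises.  So the
  located print input does NOT discharge the exact-shear lifting statement — GAP row G-c312-14-R9f
  STANDS as the residual for the `μ·U^{(2)}`-target — while the BASE-LINE mover conclusion above is
  what it does license.  Both horns of the `μ·U^{(2)}` case at `d = 2` remain open in the tree.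

[cite: MochizukiAbsAnab2004, Prop 1.2.1 (iii) p.10] [claim: Mochizuki2012, status: disputed] for every
[IUTchIII] locution.  Consumed BY NAME, nothing restated: the UnitsShear chain (R1 g7), `unitPreimage`/
`mem_unitPreimage_iff` (Ind2IsmRigid), `image_eq_iff_liftUnits_mapsTo` (c312-1, p456209),
`exists_logSeries_eq`/`unitLog_of_isPrincipal`/`unitLog_one` (abc-iut-S1).  Nothing here asserts or
refutes [IUTchIII] Cor. 3.12; typed ≠ proved; cited ≠ endorsed.
-/

set_option autoImplicit false

noncomputable section

namespace Summit.ABC.IUTFork.Thm311.Real.UnitsShear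

open Literature.IUT.LogVolume Literature.NumberTheory.NumberFields
open NumberField IsDedekindDomain Metric IsUltrametricDist
open Summit.ABC.IUTFork.RamifiedMover
open Summit.ABC.IUTFork.Thm311.Real

/-! ## 1. Plumbing: coordinates of `Ω`, non-vanishing, `xval` of inverses -/

/-- Coordinates of `Ω`: `repr 0 = 0`, `repr 1 = 1`. [folklore] -/
theorem repr_omega : bs7.repr Omega 0 = 0 ∧ bs7.repr Omega 1 = 1 := by
  have h := repr_smul_omega (1 : ℚ_[7])
  rwa [one_smul] at h

/-- `x(u) ≠ 0` (its norm is `1`). [folklore] -/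
theorem xval_ne_zero (u : (↥(v7.adicCompletionIntegers ↥F7))ˣ) : xval u ≠ 0 := by
  intro h
  have hn := norm_xval u
  rw [h, norm_zero] at hn
  exact one_ne_zero hn.symm

/-- `x(u⁻¹) = x(u)⁻¹` in `K₇`. [folklore] -/
theorem xval_inv (u : (↥(v7.adicCompletionIntegers ↥F7))ˣ) : xval u⁻¹ = (xval u)⁻¹ :=
  eq_inv_of_mul_eq_one_left (by rw [← xval_mul, inv_mul_cancel, xval_one])

/-! ## 2. The base-line sub-lattice `baseSeg` — Hoshi's `𝒪^×_{k^{(d=1)}}` read through `L₇` -/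

/-- **The base-line sub-lattice `baseSeg ⊆ K_{v₇}`**: the elements whose `K₇`-value has `Ω`-coordinate
zero (i.e. lies on the base line `ℚ₇·1` — the `d = 1` subfield locus) and norm `≤ ‖Ω‖` (the log-ball).
This is the log-image of the base-field unit line `μ·𝒪^×_{ℚ₇} ⊆ 𝒪_{v₇}^×` — Hoshi's submodule
`𝒪^×_{k^{(d=1)}} ⊆ 𝒪_k^×` at `k = K₇`, the object his Lemma 3.1 (v) proves is MOVED by some
`α ∈ Aut_top(G_k)` and his Remark 3.1.1 calls "not group-theoretic".
[cite: Hoshi2024IntrinsicHodgeTate, Lemma 3.1 and Rmk. 3.1.1 pp.10–11] -/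
def baseSeg : AddSubgroup (v7.adicCompletion ↥F7) where
  carrier := {y | bs7.repr (e7 y) 1 = 0 ∧ ‖e7 y‖ ≤ ‖Omega‖}
  add_mem' := by
    intro a b ha hb
    obtain ⟨ha1, ha2⟩ := ha
    obtain ⟨hb1, hb2⟩ := hb
    constructor
    · rw [map_add, map_add, Finsupp.add_apply, ha1, hb1, add_zero]
    · rw [map_add]
      exact (norm_add_le_max _ _).trans (max_le ha2 hb2)
  zero_mem' := by
    constructor
    · rw [map_zero, map_zero, Finsupp.coe_zero, Pi.zero_apply]
    · rw [map_zero, norm_zero]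
      positivity
  neg_mem' := by
    intro a ha
    obtain ⟨ha1, ha2⟩ := ha
    constructor
    · rw [map_neg, map_neg, Finsupp.neg_apply, ha1, neg_zero]
    · rw [map_neg, norm_neg]
      exact ha2

/-- Membership in `baseSeg`. [folklore] -/
theorem mem_baseSeg_iff (y : v7.adicCompletion ↥F7) :
    y ∈ baseSeg ↔ bs7.repr (e7 y) 1 = 0 ∧ ‖e7 y‖ ≤ ‖Omega‖ := Iff.rfl

/-- **`baseSeg ⊆ L(𝒪_{v₇}^×)`**: every element of `baseSeg` is an analytic-log value of a unit (the
tame equality clause `log₇(𝒪^×) = B(0, ‖Ω‖)`). [folklore] -/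
theorem baseSeg_subset_range :
    (baseSeg : Set (v7.adicCompletion ↥F7)) ⊆
      Set.range fun u : (↥(v7.adicCompletionIntegers ↥F7))ˣ => L7 (Additive.ofMul u) := by
  intro y hy
  rw [SetLike.mem_coe, mem_baseSeg_iff] at hy
  have hball : e7 y ∈ closedBall (0 : K7) ‖Omega‖ := by
    rw [mem_closedBall_zero_iff]
    exact hy.2
  rw [← logUnits_eq_ball] at hball
  obtain ⟨x, hx1, hxlog⟩ := hball
  rw [Set.mem_setOf_eq] at hx1
  refine ⟨unitOf hx1, ?_⟩
  show L7 (Additive.ofMul (unitOf hx1)) = y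
  rw [L7_apply, xval_unitOf, hxlog]
  exact (e7.symm_apply_apply y)

/-- **`baseSeg ≤ M₂`**: a base-line point of the log-ball has norm `≤ ‖Ω‖² = 7⁻¹` already (the value
group of `ℚ₇` misses the odd powers of `‖Ω‖` — w5-d216's parity), so the base-line target sits inside
the landed `μ·U^{(2)}`-target. [folklore] -/
theorem baseSeg_le_M2 : baseSeg ≤ M2 := by
  intro y hy
  obtain ⟨h1, h2⟩ := hy
  rw [mem_M2_iff]
  obtain ⟨ha, _⟩ := coords_of_mem_ball h2
  rw [norm_decomp, h1, norm_zero, zero_mul]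
  exact max_le ha (by positivity)

/-- **`baseSeg ≠ M₂`**: `7·Ω` lies in `M₂` but off the base line — the two mover targets are distinct
(the base-line target is a proper sub-lattice). [folklore] -/
theorem baseSeg_ne_M2 : baseSeg ≠ M2 := by
  intro hEq
  have h0 := norm_omega_pos_lt_one.1
  have h1 := norm_omega_pos_lt_one.2
  have hm : e7.symm ((7 : ℚ_[7]) • Omega) ∈ M2 := by
    rw [mem_M2_iff, e7.apply_symm_apply, norm_smul, norm_seven_q7, ← norm_omega_sq]
    nlinarith
  rw [← hEq] at hm
  obtain ⟨hco, _⟩ := hm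
  rw [e7.apply_symm_apply, (repr_smul_omega (7 : ℚ_[7])).2] at hco
  exact (by norm_num : (7 : ℚ_[7]) ≠ 0) hco

/-! ## 3. Witnesses: the criterion-currency subgroup is non-trivial and proper, and the landed shear
realisation moves `baseSeg` too -/

/-- **The log-`7` unit**: a unit `u` of `𝒪_{v₇}` with `log(x u) = 7` (successive approximation at
radius `‖Ω‖²`). [folklore] -/
theorem exists_unit_unitLog_eq_seven :
    ∃ u : (↥(v7.adicCompletionIntegers ↥F7))ˣ, unitLog (xval u) = (7 : K7) := by
  have h7K : ‖(7 : K7)‖ ≤ ‖Omega‖ ^ 2 := by rw [norm_seven_K7]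
  obtain ⟨x₀, hx₀b, hx₀l⟩ := exists_logSeries_eq 7 K7 theta_rad2_lt_one h7K
  have hx₀n : ‖x₀‖ = 1 :=
    norm_eq_one_of_norm_one_sub_lt (lt_of_le_of_lt hx₀b norm_omega_sq_lt_one)
  refine ⟨unitOf hx₀n, ?_⟩
  rw [xval_unitOf, unitLog_of_isPrincipal 7 (lt_of_le_of_lt hx₀b norm_omega_sq_lt_one), hx₀l]

/-- **Non-vacuity**: `unitPreimage L₇ baseSeg` — the tree spelling of the base-field unit line
`μ·𝒪^×_{ℚ₇}` (c312-1's criterion currency, p456209) — contains a unit with non-zero log (the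
log-`7` unit). [folklore] -/
theorem exists_mem_unitPreimage_baseSeg :
    ∃ u₀ : (↥(v7.adicCompletionIntegers ↥F7))ˣ,
      u₀ ∈ unitPreimage L7 baseSeg ∧ L7 (Additive.ofMul u₀) ≠ 0 := by
  obtain ⟨u₀, hu₀⟩ := exists_unit_unitLog_eq_seven
  have h0 := norm_omega_pos_lt_one.1
  have h1 := norm_omega_pos_lt_one.2
  have hL : L7 (Additive.ofMul u₀) = e7.symm (7 : K7) := by rw [L7_apply, hu₀]
  refine ⟨u₀, ?_, ?_⟩
  · rw [mem_unitPreimage_iff, hL, mem_baseSeg_iff, e7.apply_symm_apply]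
    refine ⟨repr_seven.2, ?_⟩
    rw [norm_seven_K7]
    nlinarith
  · rw [hL]
    intro h
    have h7 : (7 : K7) = 0 := by
      conv_lhs => rw [← e7.apply_symm_apply (7 : K7)]
      rw [h, map_zero]
    have hn := norm_seven_K7
    rw [h7, norm_zero] at hn
    nlinarith

/-- **Properness**: the log-`Ω` unit lies OUTSIDE `unitPreimage L₇ baseSeg` — the base-line subgroup
is a proper subgroup of `𝒪_{v₇}^×`, so moving it is a non-trivial assertion. [folklore] -/
theorem exists_not_mem_unitPreimage_baseSeg :
    ∃ u₁ : (↥(v7.adicCompletionIntegers ↥F7))ˣ, u₁ ∉ unitPreimage L7 baseSeg := by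
  have h1 := norm_omega_pos_lt_one.2
  obtain ⟨x₁, hx₁b, hx₁l⟩ := exists_logSeries_eq 7 K7 theta_rad1_lt_one (le_refl ‖Omega‖)
  have hx₁n : ‖x₁‖ = 1 :=
    norm_eq_one_of_norm_one_sub_lt (lt_of_le_of_lt hx₁b h1)
  refine ⟨unitOf hx₁n, ?_⟩
  rw [mem_unitPreimage_iff, L7_apply, xval_unitOf,
    unitLog_of_isPrincipal 7 (lt_of_le_of_lt hx₁b h1), hx₁l, mem_baseSeg_iff,
    e7.apply_symm_apply]
  intro hmem
  have hco := hmem.1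
  rw [repr_omega.2] at hco
  exact one_ne_zero hco

/-- **The landed shear realisation `ψ` moves `baseSeg` as well**: `ψ(e₇⁻¹ 7) = e₇⁻¹(7 + Ω)` has
`Ω`-coordinate `1` (the same escape witness as `psiShear_moves_M2`, read on the base-line target).
[folklore] -/
theorem psiShear_moves_baseSeg :
    ⇑psiShear '' (baseSeg : Set (v7.adicCompletion ↥F7)) ≠ baseSeg := by
  intro hEq
  have h0 := norm_omega_pos_lt_one.1
  have h1 := norm_omega_pos_lt_one.2
  have h7m : e7.symm (7 : K7) ∈ baseSeg := by
    rw [mem_baseSeg_iff, e7.apply_symm_apply]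
    refine ⟨repr_seven.2, ?_⟩
    rw [norm_seven_K7]
    nlinarith
  have hmem : psiShear (e7.symm (7 : K7)) ∈ ⇑psiShear '' (baseSeg : Set (v7.adicCompletion ↥F7)) :=
    ⟨e7.symm (7 : K7), h7m, rfl⟩
  rw [hEq, SetLike.mem_coe, mem_baseSeg_iff, psiShear_apply, e7.apply_symm_apply,
    e7.apply_symm_apply, glin_apply, dcoef_seven, one_smul] at hmem
  have hco := hmem.1
  rw [map_add, Finsupp.add_apply, repr_seven.2, repr_omega.2, zero_add] at hco
  exact one_ne_zero hco

/-! ## 4. The `d = 2` print-input mover: Hoshi's Lemma 3.1 (v) in the tree's currency -/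

/-- **Any realisation of a base-line-moving `φ` moves `baseSeg`**: if `ψ` realises `stripMulAut v₇ φ`
through `L₇` and THE units transport `liftUnits v₇ φ` moves the criterion-currency subgroup
`unitPreimage L₇ baseSeg`, then `ψ''(baseSeg) ≠ baseSeg`.  The mover hypothesis is the `L₇`-reading of
the "in particular" clause of Hoshi's Lemma 3.1 (v) at `k = K₇` (his `α_n^×` = the tree's
`liftUnits v₇ α`, both THE [AbsTopIII] Prop. 3.2 (iv) functoriality; mod-`μ` costs only the finite
index `μ₆`, against his NON-OPEN intersection clause).
[cite: Hoshi2024IntrinsicHodgeTate, Lemma 3.1 (v) pp.10–11] [cite: MochizukiAbsTopIII2015, Proposition 3.2 (iv) p.72]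
[claim: Mochizuki2012, status: disputed] -/
theorem moves_baseSeg_of_realises {φ : Gal v7 ≃ₜ* Gal v7}
    {ψ : v7.adicCompletion ↥F7 ≃+ v7.adicCompletion ↥F7}
    (hψ : Realises v7 L7 (stripMulAut v7 φ) ψ)
    (hm : ∃ u, u ∈ unitPreimage L7 baseSeg ∧ liftUnits v7 φ u ∉ unitPreimage L7 baseSeg) :
    ⇑ψ '' (baseSeg : Set (v7.adicCompletion ↥F7)) ≠ baseSeg := by
  obtain ⟨u₀, hu₀, hmove⟩ := hm
  rw [realises_stripMulAut_iff] at hψ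
  intro hEq
  have hmem : ψ (L7 (Additive.ofMul u₀)) ∈ ⇑ψ '' (baseSeg : Set (v7.adicCompletion ↥F7)) :=
    ⟨L7 (Additive.ofMul u₀), (mem_unitPreimage_iff L7 baseSeg u₀).mp hu₀, rfl⟩
  rw [hEq, hψ u₀, SetLike.mem_coe] at hmem
  exact hmove ((mem_unitPreimage_iff L7 baseSeg _).mpr hmem)

/-- **THE `d = 2` PRINT-INPUT (Ind1)-MOVER** (row «R9f-D2-LIT»): IF some `φ ∈ Aut_top(G_{v₇})` admits a
bicontinuous realisation through `L₇` whose units transport moves the base-field unit line — which is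
EXACTLY what Hoshi's Lemma 3.1 (v) (`d_k = 2`, `p_k` odd, so `k = K₇` qualifies) together with his
[4, Prop. 3.11 (iv)] functoriality asserts, and what Kondo's Thm. D constructs explicitly at quadratic
`k` — THEN print's (Ind1) strip part at `v₇` MOVES the base-line sub-lattice `baseSeg`: the `d = 2`
companion of the conditional `μ·U^{(2)}`-mover `ind1_strip_mover_of_lift`, with the lifting statement
replaced by the LOCATED published input.  The hypothesis stays inline (no new Prop fact, D-0067):
discharging it in the kernel needs the mono-anabelian functoriality typed at an abstract `φ`, which
the tree does not yet hold — that typing, not the existence of `α`, is now the open step.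
[cite: Hoshi2024IntrinsicHodgeTate, Lemma 3.1 (v) pp.10–11] [cite: Kondo2025OutGaloisMLF, Thm. D]
[claim: Mochizuki2012, status: disputed] -/
theorem ind1_strip_moves_baseSeg_of_mover
    (h : ∃ (φ : Gal v7 ≃ₜ* Gal v7) (ψ : v7.adicCompletion ↥F7 ≃+ v7.adicCompletion ↥F7),
        Continuous ⇑ψ ∧ Continuous ⇑ψ.symm ∧ Realises v7 L7 (stripMulAut v7 φ) ψ ∧
          ∃ u, u ∈ unitPreimage L7 baseSeg ∧ liftUnits v7 φ u ∉ unitPreimage L7 baseSeg) :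
    ∃ ψ ∈ ind1StripOf v7 L7,
      ⇑ψ '' (baseSeg : Set (v7.adicCompletion ↥F7)) ≠ baseSeg := by
  obtain ⟨φ, ψ, hc, hc', hψ, hm⟩ := h
  exact ⟨ψ, ⟨hc, hc', φ, hψ⟩, moves_baseSeg_of_realises hψ hm⟩

/-- **The c312-1 criterion at the base-line target** (p456209, instantiated): a realised strip
automorphism fixes `baseSeg` iff THE units transport and its inverse both keep `unitPreimage L₇
baseSeg` inside itself. [cite: MochizukiAbsAnab2004, Prop 1.2.1 (iii) p.10]
[claim: Mochizuki2012, status: disputed] -/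
theorem image_eq_baseSeg_iff {φ : Gal v7 ≃ₜ* Gal v7}
    {ψ : v7.adicCompletion ↥F7 ≃+ v7.adicCompletion ↥F7}
    (hψ : Realises v7 L7 (stripMulAut v7 φ) ψ) :
    ⇑ψ '' (baseSeg : Set (v7.adicCompletion ↥F7)) = baseSeg ↔
      (∀ u ∈ unitPreimage L7 baseSeg, liftUnits v7 φ u ∈ unitPreimage L7 baseSeg) ∧
        ∀ u ∈ unitPreimage L7 baseSeg, liftUnits v7 φ.symm u ∈ unitPreimage L7 baseSeg :=
  image_eq_iff_liftUnits_mapsTo v7 L7 hψ baseSeg baseSeg_subset_range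

/-! ## 5. The separation: the shear is NOT in Hoshi's unipotent class — the exact-shear residual
stands -/

/-- **The defect of the shear**, `δ(u) := α(u)·u⁻¹` — the multiplicative analogue of the endomorphism
`a ↦ β(a)·a⁻¹` of Hoshi's Lemma 3.1 (v) proof clause (b). [folklore] -/
def shearDefect (u : (↥(v7.adicCompletionIntegers ↥F7))ˣ) : (↥(v7.adicCompletionIntegers ↥F7))ˣ :=
  shearFun u * u⁻¹

/-- `x(δ u) = E(u)` — the defect's value is the defect value of the shear. [folklore] -/
theorem xval_shearDefect (u : (↥(v7.adicCompletionIntegers ↥F7))ˣ) :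
    xval (shearDefect u) = defectVal u := by
  rw [shearDefect, xval_mul, xval_shearFun, xval_inv, mul_comm (xval u) (defectVal u),
    mul_assoc, mul_inv_cancel₀ (xval_ne_zero u), mul_one]

/-- `log x(δ u) = d(log x(u))` — on logs, the defect is the linear defect map `d = g − id`. [folklore] -/
theorem unitLog_xval_shearDefect (u : (↥(v7.adicCompletionIntegers ↥F7))ˣ) :
    unitLog (xval (shearDefect u)) = dlin (unitLog (xval u)) := by
  rw [xval_shearDefect, unitLog_defectVal]

/-- **THE SEPARATION THEOREM**: the landed unit-group shear is NOT of the unipotent class Hoshi's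
Lemma 3.1 (v) constructs.  His proof clause (b) makes the square of the defect endomorphism
`a ↦ β(a)·a⁻¹` TRIVIAL; for the shear, `δ(δ(u₀)) ≠ 1` at the log-`7` unit `u₀` — on logs,
`d(d(7)) = −2·Ω ≠ 0` (`d∘d = −2·d`, the defect of an involution, not of a unipotent).  CONSEQUENCE for
GAP row G-c312-14-R9f: the located `d = 2` print input (Hoshi's `α`, Kondo's Thm. D) does NOT discharge
the exact-shear lifting statement «∃ φ, liftUnits v₇ φ = shearFun» — that residual STANDS for the
`μ·U^{(2)}`-target, and both horns of the `μ·U^{(2)}` case at `d = 2` remain open in the tree; what the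
print input licenses is the BASE-LINE mover (`ind1_strip_moves_baseSeg_of_mover`).
[cite: Hoshi2024IntrinsicHodgeTate, Lemma 3.1 (v) pp.10–11, proof clauses (a)(b)] [folklore] -/
theorem exists_shearDefect_shearDefect_ne_one :
    ∃ u₀ : (↥(v7.adicCompletionIntegers ↥F7))ˣ, shearDefect (shearDefect u₀) ≠ 1 := by
  obtain ⟨u₀, hu₀⟩ := exists_unit_unitLog_eq_seven
  refine ⟨u₀, fun hEq => ?_⟩
  have hlog : unitLog (xval (shearDefect (shearDefect u₀))) = (0 : K7) := by
    rw [hEq, xval_one, unitLog_one 7]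
  rw [unitLog_xval_shearDefect, unitLog_xval_shearDefect, hu₀, dlin_dlin, dlin_apply,
    dcoef_seven, one_smul] at hlog
  have homega : Omega ≠ 0 := by
    intro h
    have h0 := norm_omega_pos_lt_one.1
    rw [h, norm_zero] at h0
    exact lt_irrefl 0 h0
  exact smul_ne_zero (by norm_num : (-2 : ℚ_[7]) ≠ 0) homega hlog

end Summit.ABC.IUTFork.Thm311.Real.UnitsShear

end
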